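import Summits.ValiantsHypothesis.ValiantsHypothesis.Theorems.SymPencilHomogeneousHessianRank
import Summits.ValiantsHypothesis.ValiantsHypothesis.Theorems.SymPencilSdcPerSqPred
import Literature.Computability.AlgebraicComplexity.AlperBogartVelascoSubspace

/-!
# Route `SymPencil` — crux `SdcPerSq` (stmt-ValiantsHypothesis-5675): `sdc(per_n) ≥ n²` for all `n ≥ 3`

Every SYMMETRIC affine determinantal representation of the permanent `per_n`, `n ≥ 3`, over a
field of characteristic `0` has size `m ≥ n²` — for ALL `n` (the tree previously had `n² - 1` for
all `n`, `SymPencilSdcPerSqPred.sdcPerSqPred_proof`, and `n² + 1` for `n ≤ 4`,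
`SymPencilSdcPerFour.sdcPerBeyondN_of_le_four`).

Proof (`sq_le_of_isSymm_isAffineDetRepr_perPoly`).  At the Mignon–Ressayre zero `y₀` of `per_n`
the Hessian has rank `n²` (`SymPencilSdcPerSqPred.rank_hessianMatrix_perPoly_mrPoint`), and
`rank A(y₀) ≥ m - 1` by Alper–Bogart–Velasco regularity
(`AlperBogartVelasco.le_rank_map_eval_add_one`).  Since `per_n` is homogeneous of degree
`n ≠ m` (as `m ≥ n² - 1 > n`), the homogeneity drop
`SymPencilHomogeneousHessianRank.rank_hessianMatrix_le_card_of_isHomogeneous` gives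
`n² = rank Hess per_n (y₀) ≤ m`.  This replaces the route file's sketched "+1 along the cone
line" (Gauss map / Segre dimension formula) by finite-dimensional linear algebra: the cone line
is the first-order Euler identity, used through `det (A(x) + M(y) + ν A₀) = (1+ν)^(m-n) det (A(x) + M(y))`.

HONEST FRAMING: a `+1` on a quadratic lower bound in a restricted (symmetric) model; the crux
`SdcPerBeyondN` (`n² + 1`) stays open for `n ≥ 5`, and nothing here bears on `VP ≠ VNP`.
-/

noncomputable section

-- single-conjunct layout: Sub = Summit, duplicated namespace component intended
set_option linter.dupNamespace false

namespace Summit.ValiantsHypothesis.ValiantsHypothesis.Theorems.SymPencilSdcPerSq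

open Matrix MvPolynomial
open Literature.Computability.AlgebraicComplexity
open Summit.ValiantsHypothesis.ValiantsHypothesis.Theorems.SymPencilHomogeneousHessianRank
open Summit.ValiantsHypothesis.ValiantsHypothesis.Theorems.SymPencilSdcPerSqPred

/-- **`sdc(per_{m'+3}) ≥ (m'+3)²`** over any field of characteristic `0`: a symmetric affine
determinantal representation of `per_{m'+3}` of size `m` has `(m'+3)² ≤ m`. [folklore] -/
theorem sq_le_of_isSymm_isAffineDetRepr_perPoly (K : Type*) [Field K] [CharZero K] (m' : ℕ)
    {m : ℕ} {A : Matrix (Fin m) (Fin m) (MvPolynomial (Fin (m' + 3) × Fin (m' + 3)) K)}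
    (hS : A.IsSymm) (hA : IsAffineDetRepr (perPoly (Fin (m' + 3)) K) A) : (m' + 3) ^ 2 ≤ m := by
  -- the solid rung `n² ≤ m + 1`: symmetric Mignon–Ressayre at the MR point
  have hpred : (m' + 3) ^ 2 ≤ m + 1 := by
    have h := Summit.ValiantsHypothesis.Theorems.rank_hessianMatrix_le_card_add_one_of_isAffineDetRepr_of_isSymm
      hS hA (mrPoint K m') eval_mrPoint_perPoly
    rwa [rank_hessianMatrix_perPoly_mrPoint, Fintype.card_fin] at h
  by_contra hlt
  push Not at hlt
  -- so `m = n² - 1 ≠ n`, and the homogeneity drop applies at the MR point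
  have hhom : (perPoly (Fin (m' + 3)) K).IsHomogeneous (m' + 3) := by
    simpa using (perPoly_isHomogeneous (n := Fin (m' + 3)) (k := K))
  have hreg : Fintype.card (Fin m) ≤ (A.map (eval (mrPoint K m'))).rank + 1 := by
    rw [Fintype.card_fin]
    exact AlperBogartVelasco.le_rank_map_eval_add_one two_ne_zero (by omega) A hA.2 _
  have h := rank_hessianMatrix_le_card_of_isHomogeneous hhom hS hA (mrPoint K m')
    eval_mrPoint_perPoly hreg (by rw [Fintype.card_fin]; nlinarith) (by rw [Fintype.card_fin]; nlinarith)
  rw [rank_hessianMatrix_perPoly_mrPoint, Fintype.card_fin] at h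
  omega

/-- **Crux `SdcPerSq` (stmt-ValiantsHypothesis-5675) — PROVED.** For `n ≥ 3`, every symmetric
affine determinantal representation of `per_n` over `ℂ` has size `≥ n²`. [folklore] -/
theorem sdcPerSq_proof : Summit.ValiantsHypothesis.ValiantsHypothesis.Theses.SymPencil.SdcPerSq := by
  unfold Summit.ValiantsHypothesis.ValiantsHypothesis.Theses.SymPencil.SdcPerSq
  intro n hn m A hS hA
  obtain ⟨m', rfl⟩ : ∃ m', n = m' + 3 := ⟨n - 3, by omega⟩
  exact sq_le_of_isSymm_isAffineDetRepr_perPoly ℂ m' hS hA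

end Summit.ValiantsHypothesis.ValiantsHypothesis.Theorems.SymPencilSdcPerSq

end
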